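import Summits.BirchSwinnertonDyer.BirchSwinnertonDyer.Theorems.KolyvaginRankRigidityAtTwoKolyvaginNonvanishingAtTwoFrameThetaNonTorsionLevelOneTheta
import HarnessLib

/-!
# Crux V1′ₛ `KolyvaginNonvanishingAtTwoFrameStrong` (stmt-BirchSwinnertonDyer-27014),
# line `level_one_split_margin` (pen g4 registration 08:55Z): REGISTERED STUB
# `stub_nonTorsionLevelOneMargin` — THE NON-TORSION LEVEL-ONE CASE WITH ADDITIVE MARGIN
# (helper, PROVED, unconditional)

V1′ₛ asks, for every margin `k`, for a non-zero Kolyvagin class `c_M(n) ≠ 0` with `M + k ≤ M(n)`.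
When some conductor-`1` datum has `P(1)` (= `y_K` up to the frame) of infinite order this is the
`θ = 1` instance of the landed relative-margin stub `KolyvaginAtTwo.stub_nonTorsionLevelOneTheta`
(p622194: `n = 1`, `M(1) = ∞`, `c_M(1) ≠ 0` for a level `M ≥ 1` with `2^M ∤ P(1)` in `E(K[1])`).
HONEST FRAMING: the torsion case `stub_torsionLevelOneMargin` (Kolyvagin's conjecture at `2`,
strong form) is the research content and is NOT touched; V1′ₛ is not proved; BSD is not proved
by any of this.

References: [GrossLMS1991] §2, §4 (4.1), Prop. 4.7 (1); [McCallumLMS1991] §4 Cor. 4.5, §5 Lemma 5.1.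
-/

set_option autoImplicit false
-- the Theorems namespace of this sub repeats the summit name by design (D-0017 nested layout)
set_option linter.dupNamespace false

noncomputable section

open scoped Classical

open WeierstrassCurve Field Literature.NumberTheory.EllipticCurves
  Literature.NumberTheory.EllipticCurves.ModularForms

namespace Summit.BirchSwinnertonDyer.BirchSwinnertonDyer.Theorems.KolyvaginAtTwo

/-- **REGISTERED STUB `stub_nonTorsionLevelOneMargin` of the 27014 skeleton (V1′ₛ, non-torsion
case):** if some conductor-`1` datum has `P(1)` of infinite order then for every margin `k` there is
a non-zero class `c_M(1) ≠ 0`, `1 ≤ M`, with `M + k ≤ M(1) = ∞` — the `θ = 1` case of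
`stub_nonTorsionLevelOneTheta`. [cite: GrossLMS1991, §2, Prop. 4.7 (1)]
[cite: McCallumLMS1991, §4 Cor. 4.5, §5 Lemma 5.1] -/
theorem stub_nonTorsionLevelOneMargin : ∀ (W : WeierstrassCurve ℚ) [W.IsElliptic] [W.IsGloballyMinimal], ¬ W.HasCM → (Literature.NumberTheory.EllipticCurves.Rank1Residual.GoodOrd W 2 ∨ Literature.NumberTheory.EllipticCurves.Rank1Residual.Mult W 2) → (∀ m : ℕ, W.HasSurjectiveModNGaloisRep (2 ^ m : ℕ)) → ∀ (K : Type) [Field K] [NumberField K], Literature.NumberTheory.EllipticCurves.IsImaginaryQuadratic K → ∀ [NeZero (W.conductorNorm ℤ)], Literature.NumberTheory.EllipticCurves.SatisfiesHeegnerHypothesis (W.conductorNorm ℤ) K → Odd (NumberField.discr K) → NumberField.discr K ≠ -3 → AddSubgroup.torsionBy (W.baseChange K).toAffine.Point (2 : ℤ) = ⊥ → Literature.NumberTheory.EllipticCurves.SatisfiesHeegnerHypothesis 2 K → ∀ (Dt : Literature.NumberTheory.EllipticCurves.ModularForms.ModularParametrizationData W (W.conductorNorm ℤ)) (β : ℤ)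 (ι : K →+* ℂ), (4 * (W.conductorNorm ℤ : ℤ)) ∣ β ^ 2 - NumberField.discr K → (∃ d₁ : Literature.NumberTheory.EllipticCurves.KolyvaginHeegnerData Dt β ι 1, ¬ IsOfFinAddOrder d₁.derivedPoint) → ∀ k : ℕ, ∃ (n : ℕ) (d : Literature.NumberTheory.EllipticCurves.KolyvaginHeegnerData Dt β ι n) (M : ℕ), Literature.NumberTheory.EllipticCurves.KolyvaginDescent.KolSupp (Literature.NumberTheory.EllipticCurves.Zhang2014.IsKolyvaginPrime (W.conductorNorm ℤ) W K 2) n ∧ 1 ≤ M ∧ ((M + k : ℕ) : ℕ∞) ≤ Literature.NumberTheory.EllipticCurves.Zhang2014.levelIndex W 2 n ∧ d.kolyvaginClass Nat.prime_two M ≠ 0 := by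
  intro W _ _ hCM hred hsur K _ _ hK _ hHN hodd h3 htors hH2 Dt β ι hβ hex k
  obtain ⟨n, d, M, hsupp, hM1, hle, hne⟩ :=
    stub_nonTorsionLevelOneTheta W hCM hred hsur K hK hHN hodd h3 htors hH2 Dt β ι hβ hex 1 k
  exact ⟨n, d, M, hsupp, hM1, by simpa only [one_mul] using hle, hne⟩

end Summit.BirchSwinnertonDyer.BirchSwinnertonDyer.Theorems.KolyvaginAtTwo

end
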